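import Summits.KontsevichZagierPeriods.KontsevichZagierPeriods.Theses.GaussManinCertificates
import Summits.KontsevichZagierPeriods.KontsevichZagierPeriods.Theorems.XMapKernel.Negative.Core

/-!
# `CyclicMerging` (crux stmt-KontsevichZagierPeriods-14465, route `GaussManinCertificates`):
# the padding generators `[σ × [j, j+1], f ∘ init] − [σ, f]` are load-bearing — without them the
# statement is FALSE for every budget (negative-side support, refuter crux-attack seat g2)

`CyclicMerging` bounds `ker KZ.eval` by
`closure(1a ∪ 1b ∪ 2 ∪ slabs) ⊔ closure(semialgebraic Stokes instances) ⊔ closure(generic cyclic fibres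
of the budget E)`, for every budget `E`. Here we record, sorry-free, that the slab generators cannot be
dropped from the base. The separating invariant is the **dimension-0 evaluation**
`Summit.KontsevichZagierPeriods.XMapKernel.Negative.dimZeroEval : KZ.FormalRep →+ ℝ` of
`Theorems/XMapKernel/Negative/Core.lean` (REUSED, not re-declared): value on generators of dimension
`0`, `0` on all generators of positive dimension. It kills the dimension-homogeneous moves (1a), (1b),
(2) (loc. cit.), every Stokes instance (dimension `≥ 1`) and every cyclic-fibre generator (value `0` by
hypothesis, or dimension `≥ 1`) — `slabFree_le_ker_dimZeroEval` — but not the padding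
`slabWitness = [pt × [0,1], 1] − [pt, 1] ∈ ker eval` (value `−1`, loc. cit.).

* `cyclicMerging_false_without_slabs` — the crux with `{of (r.slab j) − of r}` deleted from the base
  (statement written inline; no proposition is defined under `Summits/`) is false at every budget.

Moral for provers/planners: what makes the crux's subgroup large enough is exactly that the slabs put
the Newton–Leibniz move back (base ⊔ Stokes = relations ⊔ Stokes once rule 3 is normalised into a
Stokes instance plus a slab); the cyclic fibres play no part in this. This file does NOT refute the crux
(the crux-attack verdict on the item is `restates-the-target`, see the item's evidence AttackG2.lean).
-/

noncomputable section

namespace Summit.KontsevichZagierPeriods.Theorems.CyclicMerging.Negative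

open Set
open Literature.NumberTheory.Transcendental Literature.AlgebraicGeometry.Motives
open Summit.KontsevichZagierPeriods.XMapKernel.Negative

/-- Every cyclic-fibre generator is invisible to the dimension-0 evaluation: in dimension `0` its value
is the (vanishing) period, in positive dimension `dimZeroEval` is `0`. [folklore] -/
theorem dimZeroEval_fibre_eq_zero {n : ℕ} (𝓕 : MonodromyCyclicFamily n)
    (P : MvPolynomial (Fin (n + 1)) ℚ) (k : ℕ) {t₀ : ℝ} (ht₀ : t₀ ∈ 𝓕.toPeriodFamily.J)
    (halg : IsAlgebraic ℚ t₀) (hv : 𝓕.toPeriodFamily.periodFun P k t₀ = 0) :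
    dimZeroEval (KZ.of (𝓕.toPeriodFamily.toIntegralRep t₀ ht₀ halg P k)) = 0 := by
  rw [dimZeroEval_of]
  split_ifs
  · rw [PeriodFamily.value_toIntegralRep]; exact hv
  · rfl

/-- The slab-free subgroup of `CyclicMerging` (base without padding, Stokes instances, cyclic fibres of
any budget) lies in the kernel of the dimension-0 evaluation. [folklore] -/
theorem slabFree_le_ker_dimZeroEval
    (E : (n : ℕ) → MonodromyCyclicFamily n → MvPolynomial (Fin (n + 1)) ℚ → ℕ → Finset ℝ) :
    AddSubgroup.closure (KZ.domainAddRel ∪ KZ.integrandAddRel ∪ KZ.changeOfVariablesRel) ⊔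
      AddSubgroup.closure {d : KZ.FormalRep | ∃ (n : ℕ) (r : KZ.IntegralRep (n + 1))
        (H : (Fin (n + 1) → ℝ) → ℝ), Bornology.IsBounded r.domain ∧
        IsSemialgebraicFunOn ℚ (closure r.domain) H ∧
        (∀ x : Fin n → ℝ, ContinuousOn (fun s : ℝ => H (Fin.snoc x s))
          (closure {s : ℝ | (Fin.snoc x s : Fin (n + 1) → ℝ) ∈ r.domain})) ∧
        (∀ (x : Fin n → ℝ) (t : ℝ), t ∈ frontier {s : ℝ | (Fin.snoc x s : Fin (n + 1) → ℝ) ∈ r.domain} →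
          H (Fin.snoc x t) = 0) ∧
        (∀ (x : Fin n → ℝ) (t : ℝ), t ∈ interior {s : ℝ | (Fin.snoc x s : Fin (n + 1) → ℝ) ∈ r.domain} →
          HasDerivAt (fun s : ℝ => H (Fin.snoc x s)) (r.integrand (Fin.snoc x t)) t) ∧
        d = KZ.of r} ⊔
      AddSubgroup.closure {d : KZ.FormalRep | ∃ (n : ℕ) (𝓕 : MonodromyCyclicFamily n)
        (P : MvPolynomial (Fin (n + 1)) ℚ) (k : ℕ) (t₀ : ℝ) (ht₀ : t₀ ∈ 𝓕.toPeriodFamily.J)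
        (halg : IsAlgebraic ℚ t₀), (∀ t ∈ 𝓕.toPeriodFamily.J, 𝓕.toPeriodFamily.periodFun P k t = 0) ∧
        t₀ ∉ E n 𝓕 P k ∧ d = KZ.of (𝓕.toPeriodFamily.toIntegralRep t₀ ht₀ halg P k)} ≤
      dimZeroEval.ker := by
  refine sup_le (sup_le ?_ ?_) ?_
  · refine (AddSubgroup.closure_le _).mpr ?_
    rintro d ((hd | hd) | hd)
    · exact (AddMonoidHom.mem_ker).mpr (dimZeroEval_eq_zero_of_mem_domainAddRel hd)
    · exact (AddMonoidHom.mem_ker).mpr (dimZeroEval_eq_zero_of_mem_integrandAddRel hd)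
    · exact (AddMonoidHom.mem_ker).mpr (dimZeroEval_eq_zero_of_mem_changeOfVariablesRel hd)
  · refine (AddSubgroup.closure_le _).mpr ?_
    rintro d ⟨n, r, H, -, -, -, -, -, rfl⟩
    refine (AddMonoidHom.mem_ker).mpr ?_
    simp [dimZeroEval_of]
  · refine (AddSubgroup.closure_le _).mpr ?_
    rintro d ⟨n, 𝓕, P, k, t₀, ht₀, halg, hv, -, rfl⟩
    exact (AddMonoidHom.mem_ker).mpr (dimZeroEval_fibre_eq_zero 𝓕 P k ht₀ halg (hv t₀ ht₀))

/-- **The slab generators are load-bearing in `CyclicMerging`.** With `{of (r.slab j) − of r}` removed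
from the base, the statement (otherwise verbatim, inline) fails for EVERY budget `E`: the dimension-0
evaluation kills the slab-free subgroup (`slabFree_le_ker_dimZeroEval`) but takes the value `−1` on the
padding witness `slabWitness = [pt × [0,1], 1] − [pt, 1] ∈ ker eval` (one Newton–Leibniz move).
[folklore] -/
theorem cyclicMerging_false_without_slabs
    (E : (n : ℕ) → MonodromyCyclicFamily n → MvPolynomial (Fin (n + 1)) ℚ → ℕ → Finset ℝ) :
    ¬ ∀ c : KZ.FormalRep, KZ.eval c = 0 →
      c ∈ AddSubgroup.closure (KZ.domainAddRel ∪ KZ.integrandAddRel ∪ KZ.changeOfVariablesRel) ⊔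
        AddSubgroup.closure {d : KZ.FormalRep | ∃ (n : ℕ) (r : KZ.IntegralRep (n + 1))
          (H : (Fin (n + 1) → ℝ) → ℝ), Bornology.IsBounded r.domain ∧
          IsSemialgebraicFunOn ℚ (closure r.domain) H ∧
          (∀ x : Fin n → ℝ, ContinuousOn (fun s : ℝ => H (Fin.snoc x s))
            (closure {s : ℝ | (Fin.snoc x s : Fin (n + 1) → ℝ) ∈ r.domain})) ∧
          (∀ (x : Fin n → ℝ) (t : ℝ), t ∈ frontier {s : ℝ | (Fin.snoc x s : Fin (n + 1) → ℝ) ∈ r.domain} →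
            H (Fin.snoc x t) = 0) ∧
          (∀ (x : Fin n → ℝ) (t : ℝ), t ∈ interior {s : ℝ | (Fin.snoc x s : Fin (n + 1) → ℝ) ∈ r.domain} →
            HasDerivAt (fun s : ℝ => H (Fin.snoc x s)) (r.integrand (Fin.snoc x t)) t) ∧
          d = KZ.of r} ⊔
        AddSubgroup.closure {d : KZ.FormalRep | ∃ (n : ℕ) (𝓕 : MonodromyCyclicFamily n)
          (P : MvPolynomial (Fin (n + 1)) ℚ) (k : ℕ) (t₀ : ℝ) (ht₀ : t₀ ∈ 𝓕.toPeriodFamily.J)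
          (halg : IsAlgebraic ℚ t₀), (∀ t ∈ 𝓕.toPeriodFamily.J, 𝓕.toPeriodFamily.periodFun P k t = 0) ∧
          t₀ ∉ E n 𝓕 P k ∧ d = KZ.of (𝓕.toPeriodFamily.toIntegralRep t₀ ht₀ halg P k)} := by
  intro h
  have h1 : dimZeroEval slabWitness = 0 :=
    (AddMonoidHom.mem_ker).mp (slabFree_le_ker_dimZeroEval E (h slabWitness eval_slabWitness))
  rw [dimZeroEval_slabWitness] at h1
  norm_num at h1

end Summit.KontsevichZagierPeriods.Theorems.CyclicMerging.Negative
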